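import Mathlib
import HarnessLib
import Summits.NavierStokesRegularity.NavierStokesRegularity.Theorems.TaylorModelRungThreeReadoutFlowPackageV

/-!
# Line `taylor-model` on crux K1b-DR (stmt-NavierStokesRegularity-23954) — (E) supplement F9: the DIRECTIONAL
# (sup-ω) form of the sub-step flow derivative

(F7′) of `IsFlowPackageV` exports the Fréchet derivative `L` of the sub-step flow within the outer hull box together
with its COLUMNS (their boxes and variational Taylor models).  Bounding `L v` for a general direction `v` from
column boxes loses the sup-ω structure (a factor of the window size).  The tube read-outs (G3-v: the deviation of
a κ-restart and the segment-derivative clause of K1b-DR, PROPAGATE-V-SPEC-cert1 rev. §1 «TUBE», §3) want the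
DIRECTIONAL fact, which the certificate's (V1) test gives for free: `L v` is the value at time `u` of the variational
solution started at `v`, and a start in the `r·ω`-ball stays in `r·[loV, hiV]`.  This file exports, for every hull
start `z` and every `u ∈ [0,h]`, ONE derivative `L` with all three properties:
(i) `HasFDerivWithinAt (flowSel (Qw cd) · u) L (hull box) (toVec z)`; (ii) DIRECTIONAL: `|v|_c ≤ r·ω_c` for all `c`
⇒ `L v ∈ [r·loV, r·hiV]`; (iii) COLUMNS: `|L e_c c' − Σ_{n≤p_v} varJet (Qw cd) (toVec z) e_c n c' u^n| ≤
JU c'·ω_c⁻¹·u^(p_v+1)`.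

* `exists_fderiv_directional_of_tests` — from explicit test hypotheses (cascade coordinates, as in
  `fderiv_flowSel_of_tests`);
* `exists_fderiv_directional_of_core` — per sub-step from `ChainVCore` (+ `StageNumerics`).

MODEL-lattice rung TL-M3 only; nothing here is a statement about the Navier–Stokes equations.
-/

noncomputable section

-- the sub-problem namespace repeats the summit name by design (D-0017)
set_option linter.dupNamespace false

namespace Summit.NavierStokesRegularity.NavierStokesRegularity.Theorems.TaylorModelV

open Set Finset
open Literature.Analysis.FluidPDE.TaoCascade Literature.Analysis.FluidPDE.TaoCascade.TaylorChain
open Summit.NavierStokesRegularity.NavierStokesRegularity.Theorems.TaylorModelMajorant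
open Summit.NavierStokesRegularity.NavierStokesRegularity.Theorems.TaylorModelVector
open Summit.NavierStokesRegularity.NavierStokesRegularity.Theorems.TaylorModelReadout

variable {cd : CertData} {bx : StepBoxes}

section Tests

variable {j : ℕ} {h : ℝ} {hlo hhi tlo thi loV hiV JU : Fin 4 → ℤ → ℝ} {pv : ℕ}

/-- **(F9) from tests**: ONE derivative of the sub-step flow at a hull start with the Fréchet, the DIRECTIONAL and
the COLUMN properties — see the module docstring. [folklore] -/
theorem exists_fderiv_directional_of_tests
    (hMS : IsMajorantSystem (nW cd) (Qw cd) (wW cd j) (cd.bb j) (taylorJet (Qw cd)) (varJet (Qw cd)))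
    (hω : ∀ k, 0 < cd.ω j k) (hh : 0 ≤ h)
    (hsol : ∀ zv ∈ Icc (toVec cd hlo) (toVec cd hhi),
      IsSolOn (Qw cd) zv h (fun s => flowSel (Qw cd) zv s) ∧
        ∀ u ∈ Icc 0 h, flowSel (Qw cd) zv u ∈ Icc (toVec cd tlo) (toVec cd thi))
    (hVunit : ∀ i k, -cd.Kb ≤ k → k ≤ cd.Ka → loV i k ≤ -cd.ω j k ∧ cd.ω j k ≤ hiV i k)
    (hencV : ∀ v₀ : Fin 4 → ℤ → ℝ, cd.InBall j v₀ 1 → ∀ y v : Fin 4 → ℤ → ℝ,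
      (∀ i k, -cd.Kb ≤ k → k ≤ cd.Ka → tlo i k ≤ y i k ∧ y i k ≤ thi i k) →
      (∀ i k, -cd.Kb ≤ k → k ≤ cd.Ka → loV i k ≤ v i k ∧ v i k ≤ hiV i k) → ∀ u ∈ Icc (0:ℝ) h,
        ∀ i k, -cd.Kb ≤ k → k ≤ cd.Ka →
          loV i k ≤ (v₀ + u • (cd.Qb y v + cd.Qb v y)) i k ∧ (v₀ + u • (cd.Qb y v + cd.Qb v y)) i k ≤ hiV i k)
    (hJU : ∀ y v : Fin 4 → ℤ → ℝ, (∀ i k, -cd.Kb ≤ k → k ≤ cd.Ka → tlo i k ≤ y i k ∧ y i k ≤ thi i k) →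
      (∀ i k, -cd.Kb ≤ k → k ≤ cd.Ka → loV i k ≤ v i k ∧ v i k ≤ hiV i k) →
      ∀ i k, -cd.Kb ≤ k → k ≤ cd.Ka → |varJet cd.Qb y v (pv + 1) i k| ≤ JU i k)
    {zv : Fin (nW cd) → ℝ} (hzv : zv ∈ Icc (toVec cd hlo) (toVec cd hhi)) {u : ℝ} (hu : u ∈ Icc 0 h) :
    ∃ L : (Fin (nW cd) → ℝ) →L[ℝ] (Fin (nW cd) → ℝ),
      HasFDerivWithinAt (fun yv => flowSel (Qw cd) yv u) L (Icc (toVec cd hlo) (toVec cd hhi)) zv ∧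
      (∀ (vv : Fin (nW cd) → ℝ) (r : ℝ), 0 ≤ r → (∀ c, |vv c| ≤ r * wW cd j c) →
        L vv ∈ Icc (r • toVec cd loV) (r • toVec cd hiV)) ∧
      ∀ c c', |L (Pi.single c 1) c' - ∑ k ∈ Finset.range (pv + 1), varJet (Qw cd) zv (Pi.single c 1) k c' * u ^ k|
        ≤ toVec cd JU c' * (wW cd j c)⁻¹ * u ^ (pv + 1) := by
  have hwpos : ∀ c, 0 < wW cd j c := wW_pos cd hω
  obtain ⟨Qb, hQb⟩ := exists_bundle hMS
  obtain ⟨W, hW0, hWder, hWbox, hF, hT⟩ := fderiv_flowSel_of_tests hMS hω hh hsol hVunit hencV hJU hzv hu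
  -- the explicit derivative of `fderiv_flowSel_of_tests`; its columns are `(wW c)⁻¹ • W c u`
  set L : (Fin (nW cd) → ℝ) →L[ℝ] (Fin (nW cd) → ℝ) :=
    ∑ c, (ContinuousLinearMap.proj c : (Fin (nW cd) → ℝ) →L[ℝ] ℝ).smulRight ((wW cd j c)⁻¹ • W c u) with hL
  have hLapply : ∀ vv : Fin (nW cd) → ℝ, L vv = ∑ c, vv c • ((wW cd j c)⁻¹ • W c u) := by
    intro vv
    rw [hL, _root_.sum_apply]
    refine Finset.sum_congr rfl fun c _ => ?_
    simp [ContinuousLinearMap.smulRight_apply]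
  have hLcol : ∀ c, L (Pi.single c 1) = (wW cd j c)⁻¹ • W c u := by
    intro c
    rw [hLapply, Finset.sum_eq_single c (fun c'' _ hc => by simp [Pi.single_eq_of_ne hc])
      (fun hc => absurd (Finset.mem_univ c) hc)]
    simp
  -- (V1) test in window coordinates and the trajectory facts
  have hencV' : ∀ v₀ : Fin (nW cd) → ℝ, (∀ c, |v₀ c| ≤ 1 * wW cd j c) →
      ∀ yv ∈ Icc (toVec cd tlo) (toVec cd thi), ∀ vv ∈ Icc (toVec cd loV) (toVec cd hiV), ∀ u ∈ Icc (0:ℝ) h,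
        v₀ + u • (Qb yv vv + Qb vv yv) ∈ Icc (toVec cd loV) (toVec cd hiV) := by
    intro v₀ hv₀ yv hyv vv hvv u hu
    have h1 := hencV (ofVec cd v₀) ((inBall_ofVec_iff cd j v₀ 1).2 hv₀) (ofVec cd yv) (ofVec cd vv)
      (ofVec_window_bounds (cd := cd) hyv) (ofVec_window_bounds (cd := cd) hvv) u hu
    have h2 := toVec_mem_Icc_of_bounds (cd := cd) h1
    rw [toVec_add, toVec_smul, toVec_add, toVec_ofVec] at h2
    simpa [hQb, Qw] using h2
  have hunitV : ∀ v₁ : Fin (nW cd) → ℝ, (∀ c, |v₁ c| ≤ 1 * wW cd j c) → v₁ ∈ Icc (toVec cd loV) (toVec cd hiV) := by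
    intro v₁ hv₁
    refine ⟨fun c' => ?_, fun c' => ?_⟩
    · have a := (abs_le.1 (hv₁ c')).1
      have b := (hVunit (modeOf cd c') (shellOf cd c') (shellOf_mem cd c').1 (shellOf_mem cd c').2).1
      simp only [toVec, wW, one_mul] at a b ⊢; linarith
    · have a := (abs_le.1 (hv₁ c')).2
      have b := (hVunit (modeOf cd c') (shellOf cd c') (shellOf_mem cd c').1 (shellOf_mem cd c').2).2
      simp only [toVec, wW, one_mul] at a b ⊢; linarith
  obtain ⟨hsolz, hboxz⟩ := hsol zv hzv
  have hψ : ∀ s ∈ Icc 0 h, HasDerivWithinAt (fun s => flowSel (Qw cd) zv s)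
      (Qb (flowSel (Qw cd) zv s) (flowSel (Qw cd) zv s)) (Icc 0 h) s := by
    simpa only [hQb] using hsolz.2
  have hcont : ContinuousOn (fun s => flowSel (Qw cd) zv s) (Icc 0 h) := fun s hs => (hψ s hs).continuousWithinAt
  have hR : ∀ s ∈ Icc 0 h, ‖flowSel (Qw cd) zv s‖ ≤ max ‖toVec cd tlo‖ ‖toVec cd thi‖ :=
    fun s hs => norm_le_of_mem_Icc (hboxz s hs)
  have hWder' : ∀ c, ∀ s ∈ Icc 0 h, HasDerivWithinAt (W c)
      (Qb (flowSel (Qw cd) zv s) (W c s) + Qb (W c s) (flowSel (Qw cd) zv s)) (Icc 0 h) s :=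
    fun c s hs => by simpa only [hQb] using hWder c s hs
  refine ⟨L, hF, fun vv r hr hvv => ?_, fun c c' => ?_⟩
  · -- DIRECTIONAL: `L vv` is the value at `u` of the variational solution from `vv`
    set V : ℝ → Fin (nW cd) → ℝ := fun s => ∑ c, vv c • ((wW cd j c)⁻¹ • W c s) with hV
    have hV0 : V 0 = vv := by
      have e : ∀ c, vv c • ((wW cd j c)⁻¹ • W c 0) = Pi.single c (vv c) := by
        intro c
        rw [hW0 c, smul_smul ((wW cd j c)⁻¹), inv_mul_cancel₀ (hwpos c).ne', one_smul]
        ext c'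
        by_cases hcc : c' = c
        · subst hcc; simp
        · simp [Pi.single_eq_of_ne hcc]
      simp only [hV, e]
      exact Finset.univ_sum_single vv
    have hVder : ∀ s ∈ Icc 0 h, HasDerivWithinAt V
        (Qb (flowSel (Qw cd) zv s) (V s) + Qb (V s) (flowSel (Qw cd) zv s)) (Icc 0 h) s := by
      intro s hs
      have h1 : HasDerivWithinAt V (∑ c, vv c • ((wW cd j c)⁻¹ •
          (Qb (flowSel (Qw cd) zv s) (W c s) + Qb (W c s) (flowSel (Qw cd) zv s)))) (Icc 0 h) s := by
        show HasDerivWithinAt (fun s => ∑ c, vv c • ((wW cd j c)⁻¹ • W c s)) _ _ _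
        have h2 := HasDerivWithinAt.sum (u := Finset.univ)
          (A := fun c s => vv c • ((wW cd j c)⁻¹ • W c s))
          (fun c _ => ((hWder' c s hs).const_smul ((wW cd j c)⁻¹)).const_smul (vv c))
        rw [Finset.sum_fn] at h2
        exact h2
      have e : ∑ c, vv c • ((wW cd j c)⁻¹ • (Qb (flowSel (Qw cd) zv s) (W c s) + Qb (W c s) (flowSel (Qw cd) zv s)))
          = Qb (flowSel (Qw cd) zv s) (V s) + Qb (V s) (flowSel (Qw cd) zv s) := by
        simp only [hV, map_sum, map_smul, LinearMap.sum_apply, LinearMap.smul_apply, smul_add,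
          Finset.sum_add_distrib]
      rw [e] at h1
      exact h1
    have hLV : L vv = V u := by rw [hLapply]
    rw [hLV]
    rcases hr.eq_or_lt with hr0 | hrpos
    · -- r = 0: vv = 0, V ≡ 0
      have hvv0 : vv = 0 := by
        funext c; have := hvv c; rw [← hr0, zero_mul] at this; exact abs_nonpos_iff.1 this
      have hVu : V u = 0 := by simp [hV, hvv0]
      rw [hVu, ← hr0, zero_smul, zero_smul]
      exact ⟨le_rfl, le_rfl⟩
    · -- r > 0: compare with the solution from `r⁻¹ • vv` (unit ball ⊆ variation box) and scale
      have hv₁ : ∀ c, |(r⁻¹ • vv) c| ≤ 1 * wW cd j c := by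
        intro c
        rw [Pi.smul_apply, smul_eq_mul, abs_mul, abs_of_pos (inv_pos.2 hrpos), one_mul]
        have := hvv c
        calc r⁻¹ * |vv c| ≤ r⁻¹ * (r * wW cd j c) := by gcongr
          _ = wW cd j c := by field_simp
      obtain ⟨U, hU0, hUder, hUbox⟩ :=
        exists_var_sol_mem_Icc_along Qb hh hcont hboxz (hunitV _ hv₁) (hencV' _ hv₁)
      -- `r • U` solves from `vv`; uniqueness gives `V = r • U` on `[0,h]`
      have hrUder : ∀ s ∈ Icc 0 h, HasDerivWithinAt (fun s => r • U s)
          (Qb (flowSel (Qw cd) zv s) (r • U s) + Qb (r • U s) (flowSel (Qw cd) zv s)) (Icc 0 h) s := by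
        intro s hs
        have h1 := (hUder s hs).const_smul r
        have e : r • (Qb (flowSel (Qw cd) zv s) (U s) + Qb (U s) (flowSel (Qw cd) zv s)) =
            Qb (flowSel (Qw cd) zv s) (r • U s) + Qb (r • U s) (flowSel (Qw cd) zv s) := by
          simp only [smul_add, map_smul, LinearMap.smul_apply]
        rw [e] at h1
        exact h1
      have heq := variational_unique Qb hR hVder hrUder (by rw [hV0, hU0, smul_smul, mul_inv_cancel₀ hrpos.ne', one_smul])
        ⟨hu.1, hu.2⟩
      simp only at heq
      rw [heq]
      have hb := hUbox u hu
      exact ⟨fun c' => by simpa using mul_le_mul_of_nonneg_left (hb.1 c') hr,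
        fun c' => by simpa using mul_le_mul_of_nonneg_left (hb.2 c') hr⟩
  · -- COLUMNS
    have key := hT c u hu c'
    rw [hLcol c, Pi.smul_apply, smul_eq_mul]
    have hw : 0 < wW cd j c := hwpos c
    have e1 : (wW cd j c)⁻¹ * W c u c' - ∑ k ∈ Finset.range (pv + 1), varJet (Qw cd) zv (Pi.single c 1) k c' * u ^ k
        = (wW cd j c)⁻¹ * (W c u c' - ∑ k ∈ Finset.range (pv + 1),
            varJet (Qw cd) zv (wW cd j c • Pi.single c 1) k c' * u ^ k) := by
      have hlin : ∀ k, varJet (Qw cd) zv (wW cd j c • Pi.single c 1) k c' =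
          wW cd j c * varJet (Qw cd) zv (Pi.single c 1) k c' := by
        intro k
        have h2 := varJet_smul (Q := Qw cd) (x := zv) (fun r a b => (isLinearMap_Qw_right cd a).map_smul r b)
          (fun r a b => (isLinearMap_Qw_left cd b).map_smul r a) (wW cd j c) (Pi.single c 1) k
        rw [h2, Pi.smul_apply, smul_eq_mul]
      simp only [hlin]
      rw [mul_sub, Finset.mul_sum]
      congr 1
      refine Finset.sum_congr rfl fun k _ => ?_
      field_simp
    rw [e1, abs_mul, abs_of_pos (inv_pos.2 hw)]
    calc (wW cd j c)⁻¹ * |W c u c' - ∑ k ∈ Finset.range (pv + 1),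
            varJet (Qw cd) zv (wW cd j c • Pi.single c 1) k c' * u ^ k|
        ≤ (wW cd j c)⁻¹ * (toVec cd JU c' * u ^ (pv + 1)) := by gcongr
      _ = toVec cd JU c' * (wW cd j c)⁻¹ * u ^ (pv + 1) := by ring

end Tests

/-- **(F9) per sub-step from `ChainVCore`**: for a start `z` of the outer hull of sub-step `(j,s')` and `u ∈ [0,h]`,
ONE derivative of the window flow with the Fréchet, DIRECTIONAL (`|v|_c ≤ r·ω_c ⇒ L v ∈ r·[loV,hiV]`) and COLUMN
(variational Taylor model with `JU`) properties. [folklore] -/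
theorem exists_fderiv_directional_of_core (hSN : cd.StageNumerics) (hC : ChainVCore cd bx) {j : ℕ} (hj : j ≤ cd.N₀)
    {s' : ℕ} (hs' : s' < cd.S j) {z : Fin 4 → ℤ → ℝ} (hz : InBox cd (bx.hlo 2 j s') (bx.hhi 2 j s') z)
    {u : ℝ} (hu : u ∈ Icc 0 (cd.h j s')) :
    ∃ L : (Fin (nW cd) → ℝ) →L[ℝ] (Fin (nW cd) → ℝ),
      HasFDerivWithinAt (fun yv => flowSel (Qw cd) yv u) L
        (Icc (toVec cd (bx.hlo 2 j s')) (toVec cd (bx.hhi 2 j s'))) (toVec cd z) ∧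
      (∀ (vv : Fin (nW cd) → ℝ) (r : ℝ), 0 ≤ r → (∀ c, |vv c| ≤ r * wW cd j c) →
        L vv ∈ Icc (r • toVec cd (bx.loV j s')) (r • toVec cd (bx.hiV j s'))) ∧
      ∀ c c', |L (Pi.single c 1) c' -
          ∑ k ∈ Finset.range (bx.pdegV + 1), varJet (Qw cd) (toVec cd z) (Pi.single c 1) k c' * u ^ k|
        ≤ toVec cd (bx.JU j s') c' * (wW cd j c)⁻¹ * u ^ (bx.pdegV + 1) := by
  have hω : ∀ k, 0 < cd.ω j k := (hSN.1 j hj).2.2.2.2.2.2.1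
  have hMS := majorantQw (cd := cd) hω (hSN.2 j hj).1 (hSN.2 j hj).2
  obtain ⟨-, -, -, hstep⟩ := hC j hj
  obtain ⟨hh, -, hE, hJ, hK0, -, -, hVincl, hVtest, -, hJU, -⟩ := hstep s' hs'
  have hh' : 0 ≤ cd.h j s' := hh.le
  have hK00 : ∀ i k, -cd.Kb ≤ k → k ≤ cd.Ka → bx.loK j s' i k ≤ 0 ∧ 0 ≤ bx.hiK j s' i k :=
    fun i k hk1 hk2 => ⟨(hK0 i k hk1 hk2).1, (hK0 i k hk1 hk2).2.1⟩
  have hJB : ∀ y : Fin 4 → ℤ → ℝ, (∀ i k, -cd.Kb ≤ k → k ≤ cd.Ka → bx.lo j s' i k ≤ y i k ∧ y i k ≤ bx.hi j s' i k) →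
      ∀ i k, -cd.Kb ≤ k → k ≤ cd.Ka → |taylorJet cd.Qb y (cd.pdeg + 1) i k| ≤ bx.J j s' i k :=
    fun y hy => hJ y (inTube_of_inBox hK00 hy)
  have hVtestB : ∀ v₀ : Fin 4 → ℤ → ℝ, cd.InBall j v₀ 1 → ∀ y v : Fin 4 → ℤ → ℝ,
      (∀ i k, -cd.Kb ≤ k → k ≤ cd.Ka → bx.lo j s' i k ≤ y i k ∧ y i k ≤ bx.hi j s' i k) →
      (∀ i k, -cd.Kb ≤ k → k ≤ cd.Ka → bx.loV j s' i k ≤ v i k ∧ v i k ≤ bx.hiV j s' i k) → ∀ u ∈ Icc (0:ℝ) (cd.h j s'),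
        ∀ i k, -cd.Kb ≤ k → k ≤ cd.Ka →
          bx.loV j s' i k ≤ (v₀ + u • (cd.Qb y v + cd.Qb v y)) i k ∧
          (v₀ + u • (cd.Qb y v + cd.Qb v y)) i k ≤ bx.hiV j s' i k :=
    fun v₀ hv₀ y v hy hv u hu => hVtest v₀ hv₀ y v (inTube2_of_inTube hK00 (inTube_of_inBox hK00 hy)) hv u hu
  have hJUB : ∀ y v : Fin 4 → ℤ → ℝ, (∀ i k, -cd.Kb ≤ k → k ≤ cd.Ka → bx.lo j s' i k ≤ y i k ∧ y i k ≤ bx.hi j s' i k) →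
      (∀ i k, -cd.Kb ≤ k → k ≤ cd.Ka → bx.loV j s' i k ≤ v i k ∧ v i k ≤ bx.hiV j s' i k) →
      ∀ i k, -cd.Kb ≤ k → k ≤ cd.Ka → |varJet cd.Qb y v (bx.pdegV + 1) i k| ≤ bx.JU j s' i k :=
    fun y v hy hv => hJU y v (inTube2_of_inTube hK00 (inTube_of_inBox hK00 hy)) hv
  have hsolW : ∀ yv ∈ Icc (toVec cd (bx.hlo 2 j s')) (toVec cd (bx.hhi 2 j s')),
      IsSolOn (Qw cd) yv (cd.h j s') (fun s => flowSel (Qw cd) yv s) ∧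
        ∀ u ∈ Icc 0 (cd.h j s'), flowSel (Qw cd) yv u ∈ Icc (toVec cd (bx.lo j s')) (toVec cd (bx.hi j s')) := by
    intro yv hyv
    have hzof := ofVec_window_bounds (cd := cd) hyv
    rcases hE with hE1 | hE2
    · obtain ⟨hx, henc⟩ := hE1 _ hzof
      have h1 := flowSel_isSolOn_mem_Icc hMS (toVec_mem_Icc_of_bounds (cd := cd) hx) hh' (roughEnclosure_toVec henc)
      rw [toVec_ofVec] at h1
      exact h1
    · have h1 := flowSel_window_of_hoTest hMS hh' hJB (hE2 _ hzof)
      rw [toVec_ofVec] at h1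
      exact ⟨h1.1, h1.2.1⟩
  exact exists_fderiv_directional_of_tests hMS hω hh' hsolW hVincl hVtestB hJUB
    (toVec_mem_Icc_of_bounds (cd := cd) hz) hu

end Summit.NavierStokesRegularity.NavierStokesRegularity.Theorems.TaylorModelV

end
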